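import Mathlib
import Literature.AlgebraicGeometry.Resolution.CobordantGame
import Literature.AlgebraicGeometry.Resolution.CobordantChartCoefficients
import Literature.AlgebraicGeometry.Resolution.AxisPolyhedron
import Summits.ResolutionOfSingularities.ResolutionOfSingularities.Theorems.WeightedInvariantLocalWeightedDropApexFreeOrderDrop
import Summits.ResolutionOfSingularities.ResolutionOfSingularities.Theorems.WeightedInvariantLocalWeightedDropAxisPreparationTaylor

/-!
# `LocalWeightedDrop` (stmt-ResolutionOfSingularities-8899), TOT2-LINE piece S-E1 (core, part 6):
# the axis vocabulary is INVARIANT UNDER MULTIPLICATION BY UNITS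

Route `ResolutionOfSingularities/WeightedInvariant`, crux `LocalWeightedDrop`, registered residual
`stub_spaceNCRankDrop` (skeleton v32), sub-line TOT2-LINE v1 §5 (E1) [OURS · L1 W4.3; AI-drafted, weaker than
expert review].  The decorated states of the count game carry germs only up to units (admissibility is radical
equivalence; the restricted-chart transport of a legal coordinate change rescales `s` by a unit), while
Hironaka's `δ(g; x'; z)` and preparedness are read on an actual series.  This file shows that nothing is lost:
for `g ∈ k[[x'₁, …, x'ₙ, z]]` and any `u` with `u(0) ≠ 0` (every field, every dimension)
* `coeff_mul_eq_zero_of_lower` — vanishing of the coefficients of `g` on a DOWN-SET of exponents passes to `u * g`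
  (any `u`); whence `aboveLevel_mul`, **`aboveLevel_mul_iff`** (`δ(u g) = δ(g)` threshold-wise) and
  `inAxisIdeal_mul_iff`;
* `coeff_mul_of_degree_eq` — in degree `d = ord g` the coefficients of `u * g` are `u(0)` times those of `g`; whence
  `axisCone_mul_iff`, `initEval_mul`, **`trivialApexX_mul_iff`**, `taylorCoeff_mul_unit`;
* `coeff_mul_of_onLine` — ON THE VERTEX LINE `γ = M (d - |a|)` of a `g` with `δ ≥ M` the coefficients of `u * g`
  are `u(0)` times those of `g`; whence **`solvable_mul_iff`** and **`preparedAxis_mul_iff`**.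
-/

set_option linter.dupNamespace false -- mandated namespace of this single-conjunct summit

namespace Summit.ResolutionOfSingularities.ResolutionOfSingularities.Theorems

open Literature.AlgebraicGeometry.Resolution

namespace AxisNearDescent

open MvPowerSeries AxisPolyhedron

variable {k : Type} [Field k] {n : ℕ}

/-! ### Down-sets of exponents -/

/-- VANISHING ON A DOWN-SET PASSES TO MULTIPLES: if the coefficients of `g` vanish on a set of exponents closed
under `≤`, so do those of `u * g`, for every `u`. -/
theorem coeff_mul_eq_zero_of_lower {σ : Type*} [DecidableEq σ] (R : Set (σ →₀ ℕ)) (hR : ∀ E ∈ R, ∀ E₁ ≤ E, E₁ ∈ R)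
    (u g : MvPowerSeries σ k) (hg : ∀ E ∈ R, coeff E g = 0) (E : σ →₀ ℕ) (hE : E ∈ R) :
    coeff E (u * g) = 0 := by
  rw [MvPowerSeries.coeff_mul]
  refine Finset.sum_eq_zero fun q hq => ?_
  have hq' := Finset.HasAntidiagonal.mem_antidiagonal.mp hq
  rw [hg q.2 (hR E hE q.2 (by rw [← hq']; exact le_add_self)), mul_zero]

/-- `δ ≥ r/q` passes to every multiple. -/
theorem aboveLevel_mul {d r q : ℕ} {g : MvPowerSeries (Fin (n + 1)) k} (u : MvPowerSeries (Fin (n + 1)) k)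
    (h : AboveLevel d r q g) : AboveLevel d r q (u * g) := by
  intro E hx hlt
  refine coeff_mul_eq_zero_of_lower {E : Fin (n + 1) →₀ ℕ | xDeg E < d ∧ q * E (Fin.last n) < r * (d - xDeg E)}
    ?_ u g (fun E hE => h E hE.1 hE.2) E ⟨hx, hlt⟩
  rintro E ⟨hEx, hElt⟩ E₁ hle
  have hx₁ : xDeg E₁ ≤ xDeg E := Finset.sum_le_sum fun j _ => hle (Fin.castSucc j)
  have hz₁ : E₁ (Fin.last n) ≤ E (Fin.last n) := hle (Fin.last n)
  refine ⟨lt_of_le_of_lt hx₁ hEx, ?_⟩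
  calc q * E₁ (Fin.last n) ≤ q * E (Fin.last n) := Nat.mul_le_mul_left q hz₁
    _ < r * (d - xDeg E) := hElt
    _ ≤ r * (d - xDeg E₁) := Nat.mul_le_mul_left r (by omega)

/-- **`δ(u · g) = δ(g)` FOR A UNIT `u`**, threshold form. -/
theorem aboveLevel_mul_iff {d r q : ℕ} {g u : MvPowerSeries (Fin (n + 1)) k} (hu : constantCoeff u ≠ 0) :
    AboveLevel d r q (u * g) ↔ AboveLevel d r q g := by
  refine ⟨fun h => ?_, aboveLevel_mul u⟩
  have h' := aboveLevel_mul u⁻¹ h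
  rwa [← mul_assoc, MvPowerSeries.inv_mul_cancel _ hu, one_mul] at h'

/-- `g ∈ (x')^d` passes to every multiple. -/
theorem inAxisIdeal_mul {d : ℕ} {g : MvPowerSeries (Fin (n + 1)) k} (u : MvPowerSeries (Fin (n + 1)) k)
    (h : InAxisIdeal d g) : InAxisIdeal d (u * g) := by
  intro E hx
  refine coeff_mul_eq_zero_of_lower {E : Fin (n + 1) →₀ ℕ | xDeg E < d} ?_ u g (fun E hE => h E hE) E hx
  intro E hE E₁ hle
  have hx₁ : xDeg E₁ ≤ xDeg E := Finset.sum_le_sum fun j _ => hle (Fin.castSucc j)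
  exact lt_of_le_of_lt hx₁ hE

/-- **`δ(u · g) = ∞ ↔ δ(g) = ∞`** for a unit `u`. -/
theorem inAxisIdeal_mul_iff {d : ℕ} {g u : MvPowerSeries (Fin (n + 1)) k} (hu : constantCoeff u ≠ 0) :
    InAxisIdeal d (u * g) ↔ InAxisIdeal d g := by
  refine ⟨fun h => ?_, inAxisIdeal_mul u⟩
  have h' := inAxisIdeal_mul u⁻¹ h
  rwa [← mul_assoc, MvPowerSeries.inv_mul_cancel _ hu, one_mul] at h'

/-! ### The degree-`d` form scales by `u(0)` -/

/-- IN DEGREE `d ≤ ord g` THE COEFFICIENTS OF `u * g` ARE `u(0)` TIMES THOSE OF `g`. -/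
theorem coeff_mul_of_degree_eq {d : ℕ} {g : MvPowerSeries (Fin (n + 1)) k}
    (hord : ∀ E : Fin (n + 1) →₀ ℕ, coeff E g ≠ 0 → d ≤ E.degree) (u : MvPowerSeries (Fin (n + 1)) k)
    {E : Fin (n + 1) →₀ ℕ} (hE : E.degree = d) : coeff E (u * g) = constantCoeff u * coeff E g := by
  rw [MvPowerSeries.coeff_mul, Finset.sum_eq_single (0, E)]
  · rw [MvPowerSeries.coeff_zero_eq_constantCoeff]
  · intro q hq hne
    have hq' := Finset.HasAntidiagonal.mem_antidiagonal.mp hq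
    by_cases hg : coeff q.2 g = 0
    · rw [hg, mul_zero]
    · exfalso
      have hd := hord q.2 hg
      have hdeg : q.1.degree + q.2.degree = d := by rw [← map_add, hq', hE]
      have h1 : q.1 = 0 := by
        have : q.1.degree = 0 := by omega
        exact (Finsupp.degree_eq_zero_iff q.1).mp this
      apply hne
      ext1
      · exact h1
      · change q.2 = E
        rw [← hq', h1, zero_add]
  · intro h
    exact absurd (Finset.HasAntidiagonal.mem_antidiagonal.mpr (by simp)) h

/-- Monomials of `u * g` also have degree `≥ d`. -/
theorem le_degree_of_coeff_mul_ne_zero {d : ℕ} {g : MvPowerSeries (Fin (n + 1)) k}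
    (hord : ∀ E : Fin (n + 1) →₀ ℕ, coeff E g ≠ 0 → d ≤ E.degree) (u : MvPowerSeries (Fin (n + 1)) k)
    (E : Fin (n + 1) →₀ ℕ) (hE : coeff E (u * g) ≠ 0) : d ≤ E.degree := by
  by_contra hlt
  push Not at hlt
  apply hE
  refine coeff_mul_eq_zero_of_lower {E : Fin (n + 1) →₀ ℕ | E.degree < d} ?_ u g ?_ E hlt
  · intro E hE E₁ hle
    refine lt_of_le_of_lt ?_ (Set.mem_setOf_eq.mp hE)
    rw [Finsupp.degree_eq_sum, Finsupp.degree_eq_sum]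
    exact Finset.sum_le_sum fun i _ => hle i
  · intro E hE
    by_contra hne
    exact absurd (hord E hne) (not_le.mpr hE)

/-- **THE AXIS CONE IS INVARIANT UNDER UNITS.** -/
theorem axisCone_mul_iff {d : ℕ} {g u : MvPowerSeries (Fin (n + 1)) k}
    (hord : ∀ E : Fin (n + 1) →₀ ℕ, coeff E g ≠ 0 → d ≤ E.degree) (hu : constantCoeff u ≠ 0) :
    AxisCone d (u * g) ↔ AxisCone d g := by
  constructor
  · intro h E hE hz
    have h' := h E hE hz
    rw [coeff_mul_of_degree_eq hord u hE] at h'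
    rcases mul_eq_zero.mp h' with h0 | h0
    · exact absurd h0 hu
    · exact h0
  · intro h E hE hz
    rw [coeff_mul_of_degree_eq hord u hE, h E hE hz, mul_zero]

/-- THE EVALUATED DEGREE-`d` FORM SCALES: `in_d (u g) (v) = u(0) · in_d g (v)`. -/
theorem initEval_mul {d : ℕ} {g : MvPowerSeries (Fin (n + 1)) k}
    (hord : ∀ E : Fin (n + 1) →₀ ℕ, coeff E g ≠ 0 → d ≤ E.degree) (u : MvPowerSeries (Fin (n + 1)) k)
    (v : Fin (n + 1) → k) :
    CobordantChart.initEval (fun _ : Fin (n + 1) => 1) v d (u * g) =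
      constantCoeff u * CobordantChart.initEval (fun _ : Fin (n + 1) => 1) v d g := by
  rw [ApexFreeOrderDrop.initEval_one_eq_sum, ApexFreeOrderDrop.initEval_one_eq_sum, Finset.mul_sum]
  refine Finset.sum_congr rfl fun e he => ?_
  have hdeg : e.degree = d := by
    rw [← ApexFreeOrderDrop.weight_one_eq_degree]
    exact (ApexFreeOrderDrop.mem_antidiag_iff d e).mp he
  rw [coeff_mul_of_degree_eq hord u hdeg, mul_assoc]

/-- **THE TRIVIAL APEX INSIDE `z = 0` IS INVARIANT UNDER UNITS.** -/
theorem trivialApexX_mul_iff {d : ℕ} {g u : MvPowerSeries (Fin (n + 1)) k}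
    (hord : ∀ E : Fin (n + 1) →₀ ℕ, coeff E g ≠ 0 → d ≤ E.degree) (hu : constantCoeff u ≠ 0) :
    TrivialApexX d (u * g) ↔ TrivialApexX d g := by
  constructor
  · intro h w hw
    obtain ⟨v, hv⟩ := h w hw
    refine ⟨v, fun heq => hv ?_⟩
    rw [initEval_mul hord, initEval_mul hord, heq]
  · intro h w hw
    obtain ⟨v, hv⟩ := h w hw
    refine ⟨v, fun heq => hv ?_⟩
    rw [initEval_mul hord, initEval_mul hord] at heq
    exact mul_left_cancel₀ hu heq

/-- The Hasse–Taylor coefficients scale by `u(0)`. -/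
theorem taylorCoeff_mul_unit {d : ℕ} {g : MvPowerSeries (Fin (n + 1)) k}
    (hord : ∀ E : Fin (n + 1) →₀ ℕ, coeff E g ≠ 0 → d ≤ E.degree) (u : MvPowerSeries (Fin (n + 1)) k)
    (lam : Fin n → k) (E : Fin (n + 1) →₀ ℕ) :
    taylorCoeff d (u * g) lam E = constantCoeff u * taylorCoeff d g lam E := by
  rw [AxisPreparation.taylorCoeff_eq_sum, AxisPreparation.taylorCoeff_eq_sum, Finset.mul_sum]
  refine Finset.sum_congr rfl fun B hB => ?_
  obtain ⟨hdeg, -⟩ := AxisPreparation.mem_axisExps.mp hB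
  rw [coeff_mul_of_degree_eq hord u hdeg, mul_assoc]

/-! ### The vertex line scales by `u(0)` -/

/-- **ON THE VERTEX LINE THE COEFFICIENTS SCALE**: for `g` with `δ ≥ M` (and monomials in degree `≥ d`) and an
exponent `E = (a, M(d - |a|))`, `|a| < d`, the coefficient of `u * g` at `E` is `u(0) g_E` — every other
contribution comes from a monomial of `g` strictly below the line or of degree `< d`. -/
theorem coeff_mul_of_onLine {d M : ℕ} {g : MvPowerSeries (Fin (n + 1)) k}
    (hord : ∀ E : Fin (n + 1) →₀ ℕ, coeff E g ≠ 0 → d ≤ E.degree) (hlev : AboveLevel d M 1 g)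
    (u : MvPowerSeries (Fin (n + 1)) k) {E : Fin (n + 1) →₀ ℕ} (hx : xDeg E < d)
    (hz : E (Fin.last n) = M * (d - xDeg E)) : coeff E (u * g) = constantCoeff u * coeff E g := by
  rw [MvPowerSeries.coeff_mul, Finset.sum_eq_single (0, E)]
  · rw [MvPowerSeries.coeff_zero_eq_constantCoeff]
  · intro q hq hne
    have hq' := Finset.HasAntidiagonal.mem_antidiagonal.mp hq
    by_cases hg : coeff q.2 g = 0
    · rw [hg, mul_zero]
    · exfalso
      -- `β := q.2 ≤ E`, `β ≠ E`
      have hle : q.2 ≤ E := by rw [← hq']; exact le_add_self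
      have hβne : q.2 ≠ E := by
        intro hβ
        apply hne
        have h1 : q.1 = 0 := by
          have h := hq'
          rw [hβ] at h
          exact add_eq_right.mp h
        ext1
        · exact h1
        · exact hβ
      have hxβ : xDeg q.2 ≤ xDeg E := Finset.sum_le_sum fun j _ => hle (Fin.castSucc j)
      have hzβ : q.2 (Fin.last n) ≤ E (Fin.last n) := hle (Fin.last n)
      have hd := hord q.2 hg
      have hdegβ := AxisPreparation.degree_eq_xDeg_add q.2
      -- either the `x'`-part drops, or it is the same and the `z`-exponent drops
      rcases lt_or_eq_of_le hxβ with hxlt | hxeq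
      · -- `|a_β| < |a|`: then `β_z ≤ M(d-|a|) < M(d-|a_β|)` unless `M = 0` (then degree `< d`)
        rcases Nat.eq_zero_or_pos M with hM | hM
        · rw [hM, zero_mul] at hz
          omega
        · refine hg (hlev q.2 (by omega) ?_)
          rw [one_mul]
          calc q.2 (Fin.last n) ≤ M * (d - xDeg E) := hz ▸ hzβ
            _ < M * (d - xDeg q.2) := Nat.mul_lt_mul_of_pos_left (by omega) hM
      · -- same `x'`-degree: the `x'`-parts agree, so `β_z < E_z`
        have hxpart : ∀ j : Fin n, q.2 (Fin.castSucc j) = E (Fin.castSucc j) := by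
          have h := (Finset.sum_eq_sum_iff_of_le (fun j _ => hle (Fin.castSucc j))).mp hxeq
          exact fun j => h j (Finset.mem_univ j)
        have hzlt : q.2 (Fin.last n) < E (Fin.last n) := by
          refine lt_of_le_of_ne hzβ fun hzeq => hβne ?_
          ext l
          rcases Fin.eq_castSucc_or_eq_last l with ⟨j, rfl⟩ | rfl
          · exact hxpart j
          · exact hzeq
        refine hg (hlev q.2 (by omega) ?_)
        rw [one_mul, hxeq, ← hz]
        exact hzlt
  · intro h
    exact absurd (Finset.HasAntidiagonal.mem_antidiagonal.mpr (by simp)) h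

/-- **SOLVABLE VERTICES ARE INVARIANT UNDER UNITS.** -/
theorem solvable_mul_iff {d M : ℕ} {g u : MvPowerSeries (Fin (n + 1)) k}
    (hord : ∀ E : Fin (n + 1) →₀ ℕ, coeff E g ≠ 0 → d ≤ E.degree) (hu : constantCoeff u ≠ 0)
    (lam : Fin n → k) : Solvable d M lam (u * g) ↔ Solvable d M lam g := by
  constructor
  · rintro ⟨hlev, h⟩
    have hlev' : AboveLevel d M 1 g := (aboveLevel_mul_iff hu).mp hlev
    refine ⟨hlev', fun E hx hz => ?_⟩
    have h' := h E hx hz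
    rw [coeff_mul_of_onLine hord hlev' u hx hz, taylorCoeff_mul_unit hord] at h'
    exact mul_left_cancel₀ hu h'
  · rintro ⟨hlev, h⟩
    refine ⟨aboveLevel_mul u hlev, fun E hx hz => ?_⟩
    rw [coeff_mul_of_onLine hord hlev u hx hz, taylorCoeff_mul_unit hord, h E hx hz]

/-- **PREPAREDNESS IS INVARIANT UNDER UNITS.** -/
theorem preparedAxis_mul_iff {d : ℕ} {g u : MvPowerSeries (Fin (n + 1)) k}
    (hord : ∀ E : Fin (n + 1) →₀ ℕ, coeff E g ≠ 0 → d ≤ E.degree) (hu : constantCoeff u ≠ 0) :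
    PreparedAxis d (u * g) ↔ PreparedAxis d g := by
  constructor
  · intro h M lam hlam hsol
    exact h M lam hlam ((solvable_mul_iff hord hu lam).mpr hsol)
  · intro h M lam hlam hsol
    exact h M lam hlam ((solvable_mul_iff hord hu lam).mp hsol)

end AxisNearDescent

end Summit.ResolutionOfSingularities.ResolutionOfSingularities.Theorems
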